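import Summits.BirchSwinnertonDyer.BirchSwinnertonDyer.Theses.DefiniteGrossPeriodAtTwo
import Literature.NumberTheory.EllipticCurves.ComplexMultiplicationHasCMIffProofs
import Literature.NumberTheory.QuadraticFields.ClassNumberOneLandauProofs
import Literature.NumberTheory.EllipticCurves.BSDRootNumberSmallConductorProofs

/-!
# Route `DefiniteGrossPeriodAtTwo`: glue of the split of crux X_Kato `KatoBoundAtTwo` by reduction type at 2 (LINE 12)

Item stmt-BirchSwinnertonDyer-27848 (`KatoBoundAtTwoOfUpperHalves`, glue of the gen-1 split of crux
stmt-BirchSwinnertonDyer-23666 `KatoBoundAtTwo` into the four EULER-SYSTEM (upper) halves in Miller currency —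
stmt-19922 `MultUpperHalfAtTwo`, stmt-27845 `OrdUpperHalfAtTwo`, stmt-27846 `SupersingularUpperHalfAtTwo`,
stmt-27847 `AdditiveUpperHalfAtTwo` — and the print support stmt-19921 `RankFinitenessInput` (GZK by name)).
THEOREM-ONLY file (no definition, no named fact, no `sorry`).

The glue is bookkeeping: for each member `X ∈ {E, E^(d)}` of the crux (the curve on the habitat and its prime-to-`2N`
quadratic twists) split on the reduction type of `X` at `2` (good supersingular / good ordinary / multiplicative /
additive) and take the matching half `ord₂ #Ш(X) ≤ ord₂ #Ш_an(X)`; Gross–Zagier–Kolyvagin (analytic rank `0` ⇒ `Ш(X)`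
finite) converts `#Ш` into the crux's `2`-primary clause (`padicValNat_card_addPrimaryComponent`); the twists are
non-CM because `j` is invariant under quadratic twist and variable change and `HasCM ↔ j ∈ cmJInvariants`
(`hasCM_iff_j_mem_of_heegnerStarkPrime` with the landed Heegner–Stark fact). BSD is not proved by any of this; the
parent crux is not proved by this file either (it closes the GLUE item only: children ⟹ parent).
-/

set_option autoImplicit false
set_option linter.dupNamespace false

namespace Summit.BirchSwinnertonDyer.BirchSwinnertonDyer.Theorems.DefiniteGrossGlue

open Summit.BirchSwinnertonDyer.BirchSwinnertonDyer.Theses.DefiniteGrossPeriodAtTwo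

/-- **Glue of the LINE-12 split of `KatoBoundAtTwo` by reduction type at 2** (item stmt-BirchSwinnertonDyer-27848, by
name): `MultUpperHalfAtTwo → OrdUpperHalfAtTwo → SupersingularUpperHalfAtTwo → AdditiveUpperHalfAtTwo →
RankFinitenessInput → KatoBoundAtTwo`. Proof: tetrachotomy of the reduction type at `2` of each member, GZK
finiteness, `j`-invariance of CM. [folklore] [cite: Miller2011LMS, Def. 1.1 (arXiv:1010.2431 p. 3)] -/
theorem katoBoundAtTwoOfUpperHalves_proof : KatoBoundAtTwoOfUpperHalves := by
  intro hM hO hS hA hGZK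
  have key : ∀ (X : WeierstrassCurve ℚ) [X.IsElliptic] [X.IsGloballyMinimal], ¬ X.HasCM →
      X.analyticRank = 0 → (Finite (AddCommGroup.primaryComponent X.sha 2) ∧ ∃ q : ℚ, Literature.NumberTheory.EllipticCurves.shaAn X = (q : ℂ) ∧ ((padicValNat 2 (Nat.card (AddCommGroup.primaryComponent X.sha 2)) : ℤ) ≤ padicValRat 2 q)) := by
    intro X _ _ hcm hr
    have hU : Literature.NumberTheory.EllipticCurves.Rank1Residual.Typed.MissingUpperBoundAt X 2 := by
      by_cases hg : X.HasGoodReductionAtPrime 2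
      · by_cases ha : (2 : ℤ) ∣ X.frobeniusTrace 2
        · exact hS X hcm hr ⟨hg, by exact_mod_cast ha⟩
        · exact hO X hcm hr ⟨hg, by exact_mod_cast ha⟩
      · by_cases hm : X.HasMultiplicativeReductionAtPrime 2
        · exact hM X hcm hr hm
        · exact hA X hcm hr ⟨hg, hm⟩
    obtain ⟨-, hfin⟩ := hGZK X (by omega)
    haveI : Finite X.sha := hfin
    refine ⟨Finite.of_injective _ Subtype.val_injective, ?_⟩
    obtain ⟨q, hq, hv⟩ := hU
    refine ⟨q, hq, ?_⟩
    rw [Literature.NumberTheory.EllipticCurves.padicValNat_card_addPrimaryComponent]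
    simpa [WeierstrassCurve.shaOrder] using hv
  intro W _ _ hcm _hH hr
  refine ⟨key W hcm hr, ?_⟩
  intro d hd Wd _ _ hWd hrd
  have hd0 : (d : ℚ) ≠ 0 := by
    have hdz : d ≠ 0 := by
      rintro rfl
      rw [Int.gcd_zero_left, Int.natAbs_mul] at hd
      simp at hd
    exact_mod_cast hdz
  have hiff := Literature.NumberTheory.EllipticCurves.hasCM_iff_j_mem_of_heegnerStarkPrime
    Literature.NumberTheory.QuadraticFields.BinaryQuadraticForm.HeegnerStarkPrimeThreeModEight_holds
  haveI := W.isElliptic_quadraticTwist hd0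
  have hjt : (W.quadraticTwist (d : ℚ)).j = W.j := W.j_quadraticTwist hd0
  obtain ⟨C, hC⟩ := hWd
  have hcmd : ¬ Wd.HasCM := by
    subst hC
    intro h
    apply hcm
    rw [hiff] at h ⊢
    rwa [WeierstrassCurve.variableChange_j, hjt] at h
  exact key Wd hcmd hrd

end Summit.BirchSwinnertonDyer.BirchSwinnertonDyer.Theorems.DefiniteGrossGlue
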